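import Mathlib.Data.Nat.Choose.Central
import Mathlib.Data.Nat.Choose.Sum
import Mathlib.Analysis.SpecialFunctions.Pow.Real
import Mathlib.Analysis.SpecialFunctions.Sqrt

/-!
# Handoff (rh-explicit, prove-1), Route E: the two binomial inequalities behind the entropy step of
ATTEMPT-14 §10 (LEMMA A′, step (ii′))

The analytic configuration bound for WIDE index-arithmetic selections of Bessel zeros (handoff/prove-1
ATTEMPT-14 §10) rests on the exact binomial form of the integer difference products,
`ρ_i = (n!)²/((n−i)!(n+i)!) = C(2n, n−i)/C(2n, n)`, and on the two elementary inequalities proved here: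

* `choose_mul_pow_mul_pow_le_one` — the ENTROPY BOUND in product form: `C(N,k)·p^k·(1−p)^{N−k} ≤ 1` for
  `0 ≤ p ≤ 1` (one term of the binomial expansion of `(p + (1−p))^N = 1`), whence
  `choose_two_mul_le` : `C(2n, n−i)·((n−i)/(2n))^{n−i}·((n+i)/(2n))^{n+i} ≤ 1`, i.e.
  `C(2n, n−i) ≤ 4ⁿ·e^{−n·ψ(i/n)}` with `ψ(t) = (1+t)log(1+t) + (1−t)log(1−t)` after taking logarithms;
* `four_pow_le_two_mul_sqrt_mul_centralBinom` — the WALLIS-TYPE LOWER BOUND `4ⁿ ≤ 2√n·C(2n, n)` for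
  `n ≥ 1` (Mathlib has the weaker `4ⁿ ≤ 2n·C(2n,n)`), by induction from
  `(n+1)·C(2n+2, n+1) = 2(2n+1)·C(2n, n)` and `4n(n+1) ≤ (2n+1)²`.

Together: `ρ_i ≤ 2√n·e^{−nψ(i/n)}`. Nothing here bears on RH (elementary combinatorics). [folklore]
-/

set_option linter.dupNamespace false

noncomputable section

namespace Summit.RiemannHypothesis.RiemannHypothesis.Theorems.HandoffBinomialEntropy

/-- ENTROPY BOUND, product form: a single term of the binomial expansion of `(p + (1 − p))^N = 1` is at
most `1`: `C(N,k)·p^k·(1−p)^{N−k} ≤ 1` for `0 ≤ p ≤ 1`, `k ≤ N`. [folklore] -/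
theorem choose_mul_pow_mul_pow_le_one (N k : ℕ) (hk : k ≤ N) {p : ℝ} (hp0 : 0 ≤ p) (hp1 : p ≤ 1) :
    (N.choose k : ℝ) * p ^ k * (1 - p) ^ (N - k) ≤ 1 := by
  have hsum : ∑ j ∈ Finset.range (N + 1), p ^ j * (1 - p) ^ (N - j) * (N.choose j : ℝ) = 1 := by
    have := (add_pow p (1 - p) N).symm
    rw [add_sub_cancel, one_pow] at this
    exact this
  have hle : p ^ k * (1 - p) ^ (N - k) * (N.choose k : ℝ)
      ≤ ∑ j ∈ Finset.range (N + 1), p ^ j * (1 - p) ^ (N - j) * (N.choose j : ℝ) := by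
    apply Finset.single_le_sum (f := fun j => p ^ j * (1 - p) ^ (N - j) * (N.choose j : ℝ))
    · intro j _
      have h1p : 0 ≤ 1 - p := sub_nonneg.2 hp1
      positivity
    · exact Finset.mem_range.2 (Nat.lt_succ_of_le hk)
  rw [hsum] at hle
  calc (N.choose k : ℝ) * p ^ k * (1 - p) ^ (N - k) = p ^ k * (1 - p) ^ (N - k) * (N.choose k : ℝ) := by
        ring
    _ ≤ 1 := hle

/-- The central case used in ATTEMPT-14 §10 (ii′): for `i ≤ n`,
`C(2n, n−i) · ((n−i)/(2n))^{n−i} · ((n+i)/(2n))^{n+i} ≤ 1`, i.e. `C(2n, n−i) ≤ 4ⁿ·e^{−nψ(i/n)}`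
(`ψ(t) = (1+t)log(1+t) + (1−t)log(1−t)`) after taking logarithms. [folklore] -/
theorem choose_two_mul_le (n i : ℕ) (hi : i ≤ n) (hn : 0 < n) :
    ((2 * n).choose (n - i) : ℝ) * (((n - i : ℕ) : ℝ) / (2 * n)) ^ (n - i)
      * (((n + i : ℕ) : ℝ) / (2 * n)) ^ (n + i) ≤ 1 := by
  have hN : n - i ≤ 2 * n := by omega
  have hp0 : 0 ≤ ((n - i : ℕ) : ℝ) / (2 * n) := by positivity
  have hp1 : ((n - i : ℕ) : ℝ) / (2 * n) ≤ 1 := by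
    rw [div_le_one (by positivity)]
    have : ((n - i : ℕ) : ℝ) ≤ (n : ℝ) := by exact_mod_cast Nat.sub_le n i
    linarith
  have key := choose_mul_pow_mul_pow_le_one (2 * n) (n - i) hN hp0 hp1
  have hq : 1 - ((n - i : ℕ) : ℝ) / (2 * n) = ((n + i : ℕ) : ℝ) / (2 * n) := by
    have hn' : (n : ℝ) ≠ 0 := by exact_mod_cast hn.ne'
    rw [Nat.cast_sub hi, Nat.cast_add]
    field_simp
    ring
  have hexp : 2 * n - (n - i) = n + i := by omega
  rw [hq, hexp] at key
  exact key

/-- WALLIS-TYPE LOWER BOUND for the central binomial coefficient: `4ⁿ ≤ 2√n · C(2n, n)` for `n ≥ 1`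
(Mathlib: `4ⁿ ≤ 2n·C(2n,n)`). Induction: `(n+1)·C(2n+2,n+1) = 2(2n+1)·C(2n,n)` and
`2√n·√(n+1) ≤ 2n+1`. [folklore] -/
theorem four_pow_le_two_mul_sqrt_mul_centralBinom (n : ℕ) (hn : 1 ≤ n) :
    (4 : ℝ) ^ n ≤ 2 * Real.sqrt n * (Nat.centralBinom n : ℝ) := by
  induction n, hn using Nat.le_induction with
  | base =>
      simp [Nat.centralBinom, Nat.choose]
      norm_num
  | succ n hn ih =>
      -- (n+1) C(2n+2,n+1) = 2 (2n+1) C(2n,n)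
      have hrec : ((n : ℝ) + 1) * (Nat.centralBinom (n + 1) : ℝ)
          = 2 * (2 * n + 1 : ℝ) * (Nat.centralBinom n : ℝ) := by
        have := Nat.succ_mul_centralBinom_succ n
        exact_mod_cast this
      have hn0 : (0 : ℝ) < n := by exact_mod_cast hn
      have hn1 : (0 : ℝ) < (n : ℝ) + 1 := by linarith
      set C := (Nat.centralBinom n : ℝ) with hCdef
      have hC : (0 : ℝ) < C := by rw [hCdef]; exact_mod_cast Nat.centralBinom_pos n
      -- key real inequality: 2 √n √(n+1) ≤ 2n+1  (from 4n(n+1) ≤ (2n+1)²)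
      have hkey : 2 * Real.sqrt n * Real.sqrt ((n : ℝ) + 1) ≤ 2 * n + 1 := by
        have h1 : 2 * Real.sqrt n * Real.sqrt ((n : ℝ) + 1) = Real.sqrt (4 * (n * (n + 1))) := by
          rw [show (4 : ℝ) * (n * (n + 1)) = (2 ^ 2) * (n * (n + 1)) by norm_num,
            Real.sqrt_mul (by positivity), Real.sqrt_sq (by norm_num),
            Real.sqrt_mul hn0.le, mul_assoc]
        rw [h1]
        calc Real.sqrt (4 * (n * (n + 1))) ≤ Real.sqrt ((2 * n + 1) ^ 2) :=
              Real.sqrt_le_sqrt (by nlinarith)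
          _ = 2 * n + 1 := Real.sqrt_sq (by positivity)
      have hsq1 : Real.sqrt ((n : ℝ) + 1) * Real.sqrt ((n : ℝ) + 1) = (n : ℝ) + 1 :=
        Real.mul_self_sqrt hn1.le
      have hs1 : 0 < Real.sqrt ((n : ℝ) + 1) := Real.sqrt_pos.2 hn1
      -- the cleared-denominator form: 4^(n+1) (n+1) ≤ 2 √(n+1) · 2(2n+1) C_n
      have hgoal : (4 : ℝ) ^ n * 4 * ((n : ℝ) + 1) ≤ 2 * Real.sqrt ((n : ℝ) + 1) * (2 * (2 * n + 1) * C) := by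
        calc (4 : ℝ) ^ n * 4 * ((n : ℝ) + 1) ≤ (2 * Real.sqrt n * C) * 4 * ((n : ℝ) + 1) := by
              gcongr
          _ = (Real.sqrt ((n : ℝ) + 1) * (2 * Real.sqrt n * Real.sqrt ((n : ℝ) + 1))) * (4 * C) := by
              linear_combination (-(8 : ℝ) * Real.sqrt n * C) * hsq1
          _ ≤ (Real.sqrt ((n : ℝ) + 1) * (2 * n + 1)) * (4 * C) := by
              gcongr
          _ = 2 * Real.sqrt ((n : ℝ) + 1) * (2 * (2 * n + 1) * C) := by ring
      -- C_{n+1} = 2(2n+1) C_n/(n+1)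
      have hCsucc : (Nat.centralBinom (n + 1) : ℝ) = 2 * (2 * n + 1) * C / ((n : ℝ) + 1) := by
        rw [eq_div_iff hn1.ne', mul_comm]
        exact hrec
      rw [pow_succ, Nat.cast_add, Nat.cast_one, hCsucc,
        show (2 : ℝ) * Real.sqrt ((n : ℝ) + 1) * (2 * (2 * n + 1) * C / ((n : ℝ) + 1))
          = 2 * Real.sqrt ((n : ℝ) + 1) * (2 * (2 * n + 1) * C) / ((n : ℝ) + 1) by ring,
        le_div_iff₀ hn1]
      exact hgoal

/-- The two together, in the form used in ATTEMPT-14 §10 (ii′):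
`C(2n, n−i)·((n−i)/n)^{n−i}·((n+i)/n)^{n+i} ≤ 4ⁿ ≤ 2√n·C(2n, n)`, i.e.
`ρ_i = C(2n,n−i)/C(2n,n) ≤ 2√n·e^{−nψ(i/n)}`. [folklore] -/
theorem choose_mul_le_two_mul_sqrt_mul_centralBinom (n i : ℕ) (hi : i ≤ n) (hn : 1 ≤ n) :
    ((2 * n).choose (n - i) : ℝ) * (((n - i : ℕ) : ℝ) / n) ^ (n - i) * (((n + i : ℕ) : ℝ) / n) ^ (n + i)
      ≤ 2 * Real.sqrt n * (Nat.centralBinom n : ℝ) := by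
  have h1 := choose_two_mul_le n i hi hn
  have h2 := four_pow_le_two_mul_sqrt_mul_centralBinom n hn
  have hn0 : (0 : ℝ) < n := by exact_mod_cast hn
  have h4 : (0 : ℝ) < 4 ^ n := by positivity
  -- x/(2n) = (x/n)·(1/2), and (1/2)^{n-i}·(1/2)^{n+i} = 1/4ⁿ
  have e1 : (((n - i : ℕ) : ℝ) / (2 * n)) ^ (n - i) = (((n - i : ℕ) : ℝ) / n) ^ (n - i) * (1 / 2) ^ (n - i) := by
    rw [← mul_pow]; congr 1; field_simp
  have e2 : (((n + i : ℕ) : ℝ) / (2 * n)) ^ (n + i) = (((n + i : ℕ) : ℝ) / n) ^ (n + i) * (1 / 2) ^ (n + i) := by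
    rw [← mul_pow]; congr 1; field_simp
  have e3 : (1 / 2 : ℝ) ^ (n - i) * (1 / 2) ^ (n + i) = 1 / 4 ^ n := by
    rw [← pow_add, show n - i + (n + i) = 2 * n by omega, pow_mul, one_div, one_div, ← inv_pow]
    norm_num
  rw [e1, e2] at h1
  -- h1 : C * (A * a) * (B * b) ≤ 1 with a * b = 1/4^n
  have h1' : ((2 * n).choose (n - i) : ℝ) * (((n - i : ℕ) : ℝ) / n) ^ (n - i)
      * (((n + i : ℕ) : ℝ) / n) ^ (n + i) * (1 / 4 ^ n) ≤ 1 := by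
    rw [← e3]; linarith [h1, le_refl (0 : ℝ)]
  rw [mul_one_div, div_le_one h4] at h1'
  exact h1'.trans h2

end Summit.RiemannHypothesis.RiemannHypothesis.Theorems.HandoffBinomialEntropy

end
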